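import Summits.QuantumAdvantage.QuantumAdvantage.Theorems.SosSandwichPseudoBoundedAAClassicalCornerSensitivityOSSSSqrt
import HarnessLib

/-!
# Crux `PseudoBoundedAA` (stmt-QuantumAdvantage-15237, route SosSandwich) — the three influence-type weights of the
# classical corner compared: `Infⱼ[p] ≤ Īⱼ ≤ δ̄ⱼ`

Support file (`--supports stmt-QuantumAdvantage-15237`), sequel of `…ClassicalCornerSensitivityOSSSSqrt.lean`
(`four_variance_le_sum_sqrt`: `4·Var[p] ≤ Σⱼ √(Īⱼ · δ̄ⱼ · Infⱼ[p])` for mixtures `p = Σ_k w_k [t_k accepts]`).  The three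
per-coordinate weights appearing in the classical-corner laws are ordered:

* `avgTreeInfluence_le_queryProb` — `Īⱼ ≤ δ̄ⱼ` (a pivotal coordinate is queried; per-coordinate form of
  `avgSensitivity_le_sum_queryProb`), so the geometric-mean law implies the query-probability OSSS law
  `4Var ≤ Σⱼ δ̄ⱼ √Infⱼ` of `ClassicalCornerQueryOSSS`;
* **`influence_le_avgTreeInfluence`** — `Infⱼ[p] ≤ Īⱼ` when `Σ_k w_k ≤ 1`: the influence of `j` on the MIXTURE is at most
  the mixture-average of its influences on the TREES (Cauchy–Schwarz; cancellation between trees can only lower it).  Hence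
  `Σⱼ √(Īⱼ δ̄ⱼ Infⱼ) ≥ Σⱼ √δ̄ⱼ·Infⱼ`, and the gap `Īⱼ/Infⱼ[p]` is exactly the cancellation ratio a counterexample to the
  absolute-constant `L²`-OSSS law would have to make large on the queried coordinates.

Honest label: elementary comparison lemmas for a corner calibration; no registered stub, crux or summit is closed.
Sources: H. Buhrman, R. de Wolf, TCS 288 (2002) §2.1; R. O'Donnell, *Analysis of Boolean Functions* (2014) §2, §8.6.
-/

set_option linter.dupNamespace false

noncomputable section

namespace Summit.QuantumAdvantage.QuantumAdvantage.Theorems.SosSandwich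

open Finset Function
open Literature.Computability.Complexity Literature.Computability.QuantumComplexity

namespace ClassicalCornerSensitivityOSSS

variable {N : ℕ}

/-- `Īⱼ ≤ δ̄ⱼ`: the mixture-averaged influence of `j` on the trees is at most its query probability. [cite: Wolf2002, §2.1] -/
theorem avgTreeInfluence_le_queryProb {ι : Type*} (s : Finset ι) (w : ι → ℝ) (hw : ∀ k ∈ s, 0 ≤ w k)
    (t : ι → DecisionTree N) (j : Fin N) :
    (∑ k ∈ s, w k * (((Finset.univ.filter fun x : Fin N → Bool =>
        (t k).eval (update x j true) ≠ (t k).eval (update x j false)).card : ℝ) / (2 : ℝ) ^ N)) ≤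
      ∑ k ∈ s, w k *
        (((Finset.univ.filter fun x : Fin N → Bool => j ∈ (t k).queries x).card : ℝ) / (2 : ℝ) ^ N) := by
  refine Finset.sum_le_sum fun k hk => mul_le_mul_of_nonneg_left ?_ (hw k hk)
  refine div_le_div_of_nonneg_right ?_ (by positivity)
  exact_mod_cast card_pivotal_le_card_queries (t k) j

/-- Pointwise Cauchy–Schwarz for a sub-probability mixture: `(Σ_k w_k d_k)² ≤ Σ_k w_k d_k²` when `w ≥ 0`, `Σ w ≤ 1`.
[folklore] -/
theorem sq_sum_mul_le_sum_mul_sq {ι : Type*} (s : Finset ι) (w d : ι → ℝ) (hw : ∀ k ∈ s, 0 ≤ w k)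
    (hw1 : ∑ k ∈ s, w k ≤ 1) : (∑ k ∈ s, w k * d k) ^ 2 ≤ ∑ k ∈ s, w k * d k ^ 2 := by
  have hcs := Finset.sum_mul_sq_le_sq_mul_sq s (fun k => Real.sqrt (w k)) (fun k => Real.sqrt (w k) * d k)
  have h1 : ∀ k ∈ s, Real.sqrt (w k) * (Real.sqrt (w k) * d k) = w k * d k := fun k hk => by
    rw [← mul_assoc, Real.mul_self_sqrt (hw k hk)]
  have h2 : ∀ k ∈ s, Real.sqrt (w k) ^ 2 = w k := fun k hk => Real.sq_sqrt (hw k hk)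
  have h3 : ∀ k ∈ s, (Real.sqrt (w k) * d k) ^ 2 = w k * d k ^ 2 := fun k hk => by
    rw [mul_pow, Real.sq_sqrt (hw k hk)]
  rw [Finset.sum_congr rfl h1, Finset.sum_congr rfl h2, Finset.sum_congr rfl h3] at hcs
  have h0 : 0 ≤ ∑ k ∈ s, w k * d k ^ 2 := Finset.sum_nonneg fun k hk => mul_nonneg (hw k hk) (sq_nonneg _)
  nlinarith

/-- **`Infⱼ[p] ≤ Īⱼ`.** If `p` is on the cube a sub-probability mixture `Σ_{k∈s} w_k [t_k accepts]` (`w ≥ 0`, `Σ w ≤ 1`) then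
the influence of `j` on `p` is at most the mixture-average of the influences of `j` on the trees:
`Infⱼ[p] ≤ Σ_k w_k·#{x : t_k.eval(x^{j→1}) ≠ t_k.eval(x^{j→0})}/2^N` (cancellation between trees only lowers it).
[cite: ODonnell2014, §2] -/
theorem influence_le_avgTreeInfluence {ι : Type*} (s : Finset ι) (w : ι → ℝ) (hw : ∀ k ∈ s, 0 ≤ w k)
    (hw1 : ∑ k ∈ s, w k ≤ 1) (t : ι → DecisionTree N) (p : MvPolynomial (Fin N) ℝ)
    (hp : ∀ x, evalBool p x = ∑ k ∈ s, w k * (if (t k).eval x = true then (1 : ℝ) else 0)) (j : Fin N) :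
    influence j p ≤ ∑ k ∈ s, w k * (((Finset.univ.filter fun x : Fin N → Bool =>
        (t k).eval (update x j true) ≠ (t k).eval (update x j false)).card : ℝ) / (2 : ℝ) ^ N) := by
  classical
  have h2N : (0 : ℝ) < (2 : ℝ) ^ N := by positivity
  set F : ι → (Fin N → Bool) → ℝ := fun k x => if (t k).eval x = true then (1 : ℝ) else 0 with hF
  -- `2^N Inf_j[p] = Σ_x (p(x^{j1}) − p(x^{j0}))²`
  have hinf := BooleanCorner.sum_sq_update_eq_influence p j
  -- pointwise Cauchy–Schwarz
  have hpt : ∀ x : Fin N → Bool, (evalBool p (update x j true) - evalBool p (update x j false)) ^ 2 ≤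
      ∑ k ∈ s, w k * (F k (update x j true) - F k (update x j false)) ^ 2 := by
    intro x
    have hd : evalBool p (update x j true) - evalBool p (update x j false) =
        ∑ k ∈ s, w k * (F k (update x j true) - F k (update x j false)) := by
      rw [hp, hp, ← Finset.sum_sub_distrib]
      exact Finset.sum_congr rfl fun k _ => by ring
    rw [hd]
    exact sq_sum_mul_le_sum_mul_sq s w _ hw hw1
  have hsum : (2 : ℝ) ^ N * influence j p ≤
      ∑ k ∈ s, w k * ∑ x, (F k (update x j true) - F k (update x j false)) ^ 2 := by
    rw [← hinf]
    calc ∑ x, (evalBool p (update x j true) - evalBool p (update x j false)) ^ 2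
        ≤ ∑ x, ∑ k ∈ s, w k * (F k (update x j true) - F k (update x j false)) ^ 2 :=
          Finset.sum_le_sum fun x _ => hpt x
      _ = ∑ k ∈ s, ∑ x, w k * (F k (update x j true) - F k (update x j false)) ^ 2 := Finset.sum_comm
      _ = _ := Finset.sum_congr rfl fun k _ => by rw [Finset.mul_sum]
  have hcard : ∀ k, ∑ x, (F k (update x j true) - F k (update x j false)) ^ 2 =
      ((Finset.univ.filter fun x : Fin N → Bool =>
        (t k).eval (update x j true) ≠ (t k).eval (update x j false)).card : ℝ) := fun k =>
    sum_sq_update_eq_card (t k) (F k) (fun x => rfl) j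
  simp only [hcard] at hsum
  have hre : ∑ k ∈ s, w k * (((Finset.univ.filter fun x : Fin N → Bool =>
        (t k).eval (update x j true) ≠ (t k).eval (update x j false)).card : ℝ) / (2 : ℝ) ^ N) =
      (∑ k ∈ s, w k * ((Finset.univ.filter fun x : Fin N → Bool =>
        (t k).eval (update x j true) ≠ (t k).eval (update x j false)).card : ℝ)) / (2 : ℝ) ^ N := by
    rw [Finset.sum_div]
    exact Finset.sum_congr rfl fun k _ => by ring
  rw [hre, le_div_iff₀ h2N, mul_comm]
  exact hsum

end ClassicalCornerSensitivityOSSS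

end Summit.QuantumAdvantage.QuantumAdvantage.Theorems.SosSandwich

end
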